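import Summits.ValiantsHypothesis.ValiantsHypothesis.Theorems.BarrierLeverPartitionMinorsHitByVPHiddenStatesBallCutCertKit

/-!
# Route BarrierLever — item `PartitionMinorsHitByVP` (stmt-ValiantsHypothesis-19717), line `hidden-states`:
# ★ THIRD-SHELL CORES OF SUPPORT 9 (second half, i–p) ARE SERVED — 8 computational certificates (`Lean.ofReduceBool`), every `h`

Helper file (`--supports stmt-ValiantsHypothesis-19717`, `--computational`; cell valiant-natproofs, 𝒟-side door (c), registered line
`Cruxes/PartitionMinorsHitByVP/Lines/hidden_states.lean` v10; prover seat val-np-p6 gen 22; planner SUGGESTION of record STATUS l.1903).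
Closes NO item.  NO matrix data: each core is `A, C` (the class), then `certTable` (canonical `|B_3(n)| × |B_3(n)|` matrix modulo
`65521` at the formulaic table `stdTable 7 n`), `packedLUP` (in-Lean packed pivoted LU, unverified) and ONE `native_decide` running the
VERIFIED checkers `packCheckP` / `lupPermCheck` of `…ChowBenchmarkPairsBlockPeelCertPack` (val-np-p4 g30); the kernel part is
`BallCut.exists_table_of_packCert[_map]` (`…BallCutCertKit`, val-np-p6 g22): rigidity ⇒ the standard-form matrix is `±` the canonical
integer matrix, nonsingular because its reduction mod `p` is.

THE POINT (memo HOME/val-np-p6/g21/MEMO-valnp6-g21.md §4a; chart kit j328511 of ALL totally unbalanced 3-swap classes at `t = 3`: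
24 231 classes, 24 170 path-certified, 61 CORES).  val-np-p6 g21 made the 23 cores of support `≤ 8` kernel theorems (`…ThirdShellCore36a`
… `…ThirdShellCore38n`, explicit adjugates / column splits); the 38 cores of support `9 … 15` (`130²` … `576²`) were numerical only.
This file: the cores of support 9 (second half, i–p) —
* `core39i`: `A = [[6, 7, 8], [2, 7, 8], [1, 7, 8]]`, `C = [[3, 4, 5, 8], [3, 4, 5, 7], [0, 4, 5, 8]]` (`r = |B_3(9)|`);
* `core39j`: `A = [[6, 7, 8], [2, 7, 8], [1, 7, 8]]`, `C = [[3, 4, 5, 8], [3, 4, 5, 7], [0, 5, 7, 8]]` (`r = |B_3(9)|`);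
* `core39k`: `A = [[6, 7, 8], [2, 7, 8], [2, 5, 6]]`, `C = [[3, 4, 5, 8], [3, 4, 5, 7], [0, 1, 2, 6]]` (`r = |B_3(9)|`);
* `core39l`: `A = [[6, 7, 8], [2, 7, 8], [2, 6, 8]]`, `C = [[3, 4, 5, 8], [1, 4, 5, 8], [0, 1, 3, 5]]` (`r = |B_3(9)|`);
* `core39m`: `A = [[6, 7, 8], [2, 7, 8], [2, 6, 8]]`, `C = [[3, 4, 5, 8], [3, 4, 5, 7], [0, 1, 2, 6]]` (`r = |B_3(9)|`);
* `core39n`: `A = [[6, 7, 8], [3, 4, 5], [0, 1, 2]]`, `C = [[4, 5, 7, 8], [3, 5, 6, 8], [3, 4, 6, 7]]` (`r = |B_3(9)|`);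
* `core39o`: `A = [[6, 7, 8], [3, 5, 8], [2, 5, 7]]`, `C = [[4, 5, 7, 8], [1, 2, 3, 6], [0, 2, 3, 6]]` (`r = |B_3(9)|`);
* `core39p`: `A = [[6, 7, 8], [3, 6, 8], [2, 6, 8]]`, `C = [[4, 5, 7, 8], [4, 5, 6, 7], [0, 1, 5, 7]]` (`r = |B_3(9)|`);
With its siblings (`…ThirdShellCores39A/39B/310/311/312/313315`) ALL 61 cores of the `t = 3` chart are theorems (kernel or computational
lane), so by `exists_table_threeSwap_of_unbalanced` (`…BallCutThirdShellReduction`) `S₃` at `t = 3` holds for every `h` modulo the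
24 170 lab path certificates (each of which this kit would certify the same way).

RANGE BOOKKEEPING: computational lane (`Lean.ofReduceBool` via `native_decide`, one per core); the kernel-only range of the column is
unchanged (cores of support `≤ 8`).  HONEST LABEL: classes of the conjecture column; 19717 stays OPEN; nothing on crux 14610 or VP ≠ VNP.
-/

set_option linter.dupNamespace false

namespace Summit.ValiantsHypothesis.ValiantsHypothesis.Theorems.BarrierLever.HiddenStates

open Finset

namespace BallCut

open SymbJoin MoorePeel

/-! ### Core `core39i`: `n = 9`, `A = [[6, 7, 8], [2, 7, 8], [1, 7, 8]]`, `C = [[3, 4, 5, 8], [3, 4, 5, 7], [0, 4, 5, 8]]` -/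

/-- Core `core39i`: the removed `3`-sets `A_l`. -/
def core39iA : Fin 3 → Finset (Fin 9) := ![{6, 7, 8}, {2, 7, 8}, {1, 7, 8}]

/-- Core `core39i`: the added `4`-sets `C_l`. -/
def core39iC : Fin 3 → Finset (Fin 9) := ![{3, 4, 5, 8}, {3, 4, 5, 7}, {0, 4, 5, 8}]

/-- Core `core39i`: the flat table of the canonical matrix modulo `65521` at `stdTable 7 9` (computed under evaluation). -/
def core39iTab : Array ℕ := certTable 9 3 core39iA core39iC (stdTable 7 9) 65521

/-- Core `core39i`: the packed pivoted LU candidate (unverified; validated by the checkers). -/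
def core39iLUP : Array ℕ × Array ℕ := packedLUP core39iTab (ballList 9 3).length 65521

/-- Core `core39i`: **THE CERTIFICATE CHECK** (computational, `Lean.ofReduceBool`): `L * U = P * M` entrywise mod `65521`, `diag U ≠ 0`,
`P` a permutation — for the `ballList 9 3`-indexed canonical matrix. -/
theorem core39i_check :
    (packCheckP core39iTab core39iLUP.1 core39iLUP.2 (ballList 9 3).length 65521 &&
      lupPermCheck core39iLUP.2 (lupPermInv core39iLUP.2 (ballList 9 3).length) (ballList 9 3).length) = true := by
  native_decide

/-- ★ Core `core39i` **IS SERVED** (standard form at the support `Fin 9`). -/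
theorem exists_table_core39i {r : ℕ} (u cols : Fin r → Finset (Fin 9)) (hu : Function.Injective u)
    (hU : ∀ i, ((u i).card ≤ 3 ∧ ∀ l, u i ≠ core39iA l) ∨ ∃ l, u i = core39iC l)
    (hcols : ∀ J : Finset (Fin 9), J.card ≤ 3 → ∃ k, cols k = J) :
    ∃ tx : Option (Fin 9) → Fin 9 → ℂ,
      (Matrix.of fun i k : Fin r => ∏ a ∈ u i, (tx none a + ∑ q ∈ cols k, tx (some q) a)).det ≠ 0 :=
  exists_table_of_packCert 9 3 core39iA core39iC (by decide +kernel) (by decide +kernel) (by decide +kernel) (by decide +kernel)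
    (stdTable 7 9) prime_65521 (by norm_num [packBase]) _ _ _ (Bool.and_eq_true_iff.mp core39i_check).1
    (Bool.and_eq_true_iff.mp core39i_check).2 u cols hu hU hcols

/-- ★ Core `core39i` **IS SERVED FOR EVERY `h`** (the core plus any number of free coordinates, along any `σ : Fin 9 ↪ Fin h`). -/
theorem exists_table_core39i_map (h : ℕ) (σ : Fin 9 ↪ Fin h) {r : ℕ} (u cols : Fin r → Finset (Fin h))
    (hu : Function.Injective u)
    (hU : ∀ i, ((u i).card ≤ 3 ∧ ∀ l, u i ≠ (core39iA l).map σ) ∨ ∃ l, u i = (core39iC l).map σ)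
    (hcols : ∀ J : Finset (Fin h), J.card ≤ 3 → ∃ k, cols k = J) :
    ∃ tx : Option (Fin h) → Fin h → ℂ,
      (Matrix.of fun i k : Fin r => ∏ a ∈ u i, (tx none a + ∑ q ∈ cols k, tx (some q) a)).det ≠ 0 :=
  exists_table_of_packCert_map 9 3 σ core39iA core39iC (by decide +kernel) (by decide +kernel) (by decide +kernel)
    (by decide +kernel) (stdTable 7 9) prime_65521 (by norm_num [packBase]) _ _ _
    (Bool.and_eq_true_iff.mp core39i_check).1 (Bool.and_eq_true_iff.mp core39i_check).2 u cols hu hU hcols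

/-! ### Core `core39j`: `n = 9`, `A = [[6, 7, 8], [2, 7, 8], [1, 7, 8]]`, `C = [[3, 4, 5, 8], [3, 4, 5, 7], [0, 5, 7, 8]]` -/

/-- Core `core39j`: the removed `3`-sets `A_l`. -/
def core39jA : Fin 3 → Finset (Fin 9) := ![{6, 7, 8}, {2, 7, 8}, {1, 7, 8}]

/-- Core `core39j`: the added `4`-sets `C_l`. -/
def core39jC : Fin 3 → Finset (Fin 9) := ![{3, 4, 5, 8}, {3, 4, 5, 7}, {0, 5, 7, 8}]

/-- Core `core39j`: the flat table of the canonical matrix modulo `65521` at `stdTable 7 9` (computed under evaluation). -/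
def core39jTab : Array ℕ := certTable 9 3 core39jA core39jC (stdTable 7 9) 65521

/-- Core `core39j`: the packed pivoted LU candidate (unverified; validated by the checkers). -/
def core39jLUP : Array ℕ × Array ℕ := packedLUP core39jTab (ballList 9 3).length 65521

/-- Core `core39j`: **THE CERTIFICATE CHECK** (computational, `Lean.ofReduceBool`): `L * U = P * M` entrywise mod `65521`, `diag U ≠ 0`,
`P` a permutation — for the `ballList 9 3`-indexed canonical matrix. -/
theorem core39j_check :
    (packCheckP core39jTab core39jLUP.1 core39jLUP.2 (ballList 9 3).length 65521 &&
      lupPermCheck core39jLUP.2 (lupPermInv core39jLUP.2 (ballList 9 3).length) (ballList 9 3).length) = true := by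
  native_decide

/-- ★ Core `core39j` **IS SERVED** (standard form at the support `Fin 9`). -/
theorem exists_table_core39j {r : ℕ} (u cols : Fin r → Finset (Fin 9)) (hu : Function.Injective u)
    (hU : ∀ i, ((u i).card ≤ 3 ∧ ∀ l, u i ≠ core39jA l) ∨ ∃ l, u i = core39jC l)
    (hcols : ∀ J : Finset (Fin 9), J.card ≤ 3 → ∃ k, cols k = J) :
    ∃ tx : Option (Fin 9) → Fin 9 → ℂ,
      (Matrix.of fun i k : Fin r => ∏ a ∈ u i, (tx none a + ∑ q ∈ cols k, tx (some q) a)).det ≠ 0 :=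
  exists_table_of_packCert 9 3 core39jA core39jC (by decide +kernel) (by decide +kernel) (by decide +kernel) (by decide +kernel)
    (stdTable 7 9) prime_65521 (by norm_num [packBase]) _ _ _ (Bool.and_eq_true_iff.mp core39j_check).1
    (Bool.and_eq_true_iff.mp core39j_check).2 u cols hu hU hcols

/-- ★ Core `core39j` **IS SERVED FOR EVERY `h`** (the core plus any number of free coordinates, along any `σ : Fin 9 ↪ Fin h`). -/
theorem exists_table_core39j_map (h : ℕ) (σ : Fin 9 ↪ Fin h) {r : ℕ} (u cols : Fin r → Finset (Fin h))
    (hu : Function.Injective u)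
    (hU : ∀ i, ((u i).card ≤ 3 ∧ ∀ l, u i ≠ (core39jA l).map σ) ∨ ∃ l, u i = (core39jC l).map σ)
    (hcols : ∀ J : Finset (Fin h), J.card ≤ 3 → ∃ k, cols k = J) :
    ∃ tx : Option (Fin h) → Fin h → ℂ,
      (Matrix.of fun i k : Fin r => ∏ a ∈ u i, (tx none a + ∑ q ∈ cols k, tx (some q) a)).det ≠ 0 :=
  exists_table_of_packCert_map 9 3 σ core39jA core39jC (by decide +kernel) (by decide +kernel) (by decide +kernel)
    (by decide +kernel) (stdTable 7 9) prime_65521 (by norm_num [packBase]) _ _ _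
    (Bool.and_eq_true_iff.mp core39j_check).1 (Bool.and_eq_true_iff.mp core39j_check).2 u cols hu hU hcols

/-! ### Core `core39k`: `n = 9`, `A = [[6, 7, 8], [2, 7, 8], [2, 5, 6]]`, `C = [[3, 4, 5, 8], [3, 4, 5, 7], [0, 1, 2, 6]]` -/

/-- Core `core39k`: the removed `3`-sets `A_l`. -/
def core39kA : Fin 3 → Finset (Fin 9) := ![{6, 7, 8}, {2, 7, 8}, {2, 5, 6}]

/-- Core `core39k`: the added `4`-sets `C_l`. -/
def core39kC : Fin 3 → Finset (Fin 9) := ![{3, 4, 5, 8}, {3, 4, 5, 7}, {0, 1, 2, 6}]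

/-- Core `core39k`: the flat table of the canonical matrix modulo `65521` at `stdTable 7 9` (computed under evaluation). -/
def core39kTab : Array ℕ := certTable 9 3 core39kA core39kC (stdTable 7 9) 65521

/-- Core `core39k`: the packed pivoted LU candidate (unverified; validated by the checkers). -/
def core39kLUP : Array ℕ × Array ℕ := packedLUP core39kTab (ballList 9 3).length 65521

/-- Core `core39k`: **THE CERTIFICATE CHECK** (computational, `Lean.ofReduceBool`): `L * U = P * M` entrywise mod `65521`, `diag U ≠ 0`,
`P` a permutation — for the `ballList 9 3`-indexed canonical matrix. -/
theorem core39k_check :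
    (packCheckP core39kTab core39kLUP.1 core39kLUP.2 (ballList 9 3).length 65521 &&
      lupPermCheck core39kLUP.2 (lupPermInv core39kLUP.2 (ballList 9 3).length) (ballList 9 3).length) = true := by
  native_decide

/-- ★ Core `core39k` **IS SERVED** (standard form at the support `Fin 9`). -/
theorem exists_table_core39k {r : ℕ} (u cols : Fin r → Finset (Fin 9)) (hu : Function.Injective u)
    (hU : ∀ i, ((u i).card ≤ 3 ∧ ∀ l, u i ≠ core39kA l) ∨ ∃ l, u i = core39kC l)
    (hcols : ∀ J : Finset (Fin 9), J.card ≤ 3 → ∃ k, cols k = J) :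
    ∃ tx : Option (Fin 9) → Fin 9 → ℂ,
      (Matrix.of fun i k : Fin r => ∏ a ∈ u i, (tx none a + ∑ q ∈ cols k, tx (some q) a)).det ≠ 0 :=
  exists_table_of_packCert 9 3 core39kA core39kC (by decide +kernel) (by decide +kernel) (by decide +kernel) (by decide +kernel)
    (stdTable 7 9) prime_65521 (by norm_num [packBase]) _ _ _ (Bool.and_eq_true_iff.mp core39k_check).1
    (Bool.and_eq_true_iff.mp core39k_check).2 u cols hu hU hcols

/-- ★ Core `core39k` **IS SERVED FOR EVERY `h`** (the core plus any number of free coordinates, along any `σ : Fin 9 ↪ Fin h`). -/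
theorem exists_table_core39k_map (h : ℕ) (σ : Fin 9 ↪ Fin h) {r : ℕ} (u cols : Fin r → Finset (Fin h))
    (hu : Function.Injective u)
    (hU : ∀ i, ((u i).card ≤ 3 ∧ ∀ l, u i ≠ (core39kA l).map σ) ∨ ∃ l, u i = (core39kC l).map σ)
    (hcols : ∀ J : Finset (Fin h), J.card ≤ 3 → ∃ k, cols k = J) :
    ∃ tx : Option (Fin h) → Fin h → ℂ,
      (Matrix.of fun i k : Fin r => ∏ a ∈ u i, (tx none a + ∑ q ∈ cols k, tx (some q) a)).det ≠ 0 :=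
  exists_table_of_packCert_map 9 3 σ core39kA core39kC (by decide +kernel) (by decide +kernel) (by decide +kernel)
    (by decide +kernel) (stdTable 7 9) prime_65521 (by norm_num [packBase]) _ _ _
    (Bool.and_eq_true_iff.mp core39k_check).1 (Bool.and_eq_true_iff.mp core39k_check).2 u cols hu hU hcols

/-! ### Core `core39l`: `n = 9`, `A = [[6, 7, 8], [2, 7, 8], [2, 6, 8]]`, `C = [[3, 4, 5, 8], [1, 4, 5, 8], [0, 1, 3, 5]]` -/

/-- Core `core39l`: the removed `3`-sets `A_l`. -/
def core39lA : Fin 3 → Finset (Fin 9) := ![{6, 7, 8}, {2, 7, 8}, {2, 6, 8}]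

/-- Core `core39l`: the added `4`-sets `C_l`. -/
def core39lC : Fin 3 → Finset (Fin 9) := ![{3, 4, 5, 8}, {1, 4, 5, 8}, {0, 1, 3, 5}]

/-- Core `core39l`: the flat table of the canonical matrix modulo `65521` at `stdTable 7 9` (computed under evaluation). -/
def core39lTab : Array ℕ := certTable 9 3 core39lA core39lC (stdTable 7 9) 65521

/-- Core `core39l`: the packed pivoted LU candidate (unverified; validated by the checkers). -/
def core39lLUP : Array ℕ × Array ℕ := packedLUP core39lTab (ballList 9 3).length 65521

/-- Core `core39l`: **THE CERTIFICATE CHECK** (computational, `Lean.ofReduceBool`): `L * U = P * M` entrywise mod `65521`, `diag U ≠ 0`,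
`P` a permutation — for the `ballList 9 3`-indexed canonical matrix. -/
theorem core39l_check :
    (packCheckP core39lTab core39lLUP.1 core39lLUP.2 (ballList 9 3).length 65521 &&
      lupPermCheck core39lLUP.2 (lupPermInv core39lLUP.2 (ballList 9 3).length) (ballList 9 3).length) = true := by
  native_decide

/-- ★ Core `core39l` **IS SERVED** (standard form at the support `Fin 9`). -/
theorem exists_table_core39l {r : ℕ} (u cols : Fin r → Finset (Fin 9)) (hu : Function.Injective u)
    (hU : ∀ i, ((u i).card ≤ 3 ∧ ∀ l, u i ≠ core39lA l) ∨ ∃ l, u i = core39lC l)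
    (hcols : ∀ J : Finset (Fin 9), J.card ≤ 3 → ∃ k, cols k = J) :
    ∃ tx : Option (Fin 9) → Fin 9 → ℂ,
      (Matrix.of fun i k : Fin r => ∏ a ∈ u i, (tx none a + ∑ q ∈ cols k, tx (some q) a)).det ≠ 0 :=
  exists_table_of_packCert 9 3 core39lA core39lC (by decide +kernel) (by decide +kernel) (by decide +kernel) (by decide +kernel)
    (stdTable 7 9) prime_65521 (by norm_num [packBase]) _ _ _ (Bool.and_eq_true_iff.mp core39l_check).1
    (Bool.and_eq_true_iff.mp core39l_check).2 u cols hu hU hcols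

/-- ★ Core `core39l` **IS SERVED FOR EVERY `h`** (the core plus any number of free coordinates, along any `σ : Fin 9 ↪ Fin h`). -/
theorem exists_table_core39l_map (h : ℕ) (σ : Fin 9 ↪ Fin h) {r : ℕ} (u cols : Fin r → Finset (Fin h))
    (hu : Function.Injective u)
    (hU : ∀ i, ((u i).card ≤ 3 ∧ ∀ l, u i ≠ (core39lA l).map σ) ∨ ∃ l, u i = (core39lC l).map σ)
    (hcols : ∀ J : Finset (Fin h), J.card ≤ 3 → ∃ k, cols k = J) :
    ∃ tx : Option (Fin h) → Fin h → ℂ,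
      (Matrix.of fun i k : Fin r => ∏ a ∈ u i, (tx none a + ∑ q ∈ cols k, tx (some q) a)).det ≠ 0 :=
  exists_table_of_packCert_map 9 3 σ core39lA core39lC (by decide +kernel) (by decide +kernel) (by decide +kernel)
    (by decide +kernel) (stdTable 7 9) prime_65521 (by norm_num [packBase]) _ _ _
    (Bool.and_eq_true_iff.mp core39l_check).1 (Bool.and_eq_true_iff.mp core39l_check).2 u cols hu hU hcols

/-! ### Core `core39m`: `n = 9`, `A = [[6, 7, 8], [2, 7, 8], [2, 6, 8]]`, `C = [[3, 4, 5, 8], [3, 4, 5, 7], [0, 1, 2, 6]]` -/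

/-- Core `core39m`: the removed `3`-sets `A_l`. -/
def core39mA : Fin 3 → Finset (Fin 9) := ![{6, 7, 8}, {2, 7, 8}, {2, 6, 8}]

/-- Core `core39m`: the added `4`-sets `C_l`. -/
def core39mC : Fin 3 → Finset (Fin 9) := ![{3, 4, 5, 8}, {3, 4, 5, 7}, {0, 1, 2, 6}]

/-- Core `core39m`: the flat table of the canonical matrix modulo `65521` at `stdTable 7 9` (computed under evaluation). -/
def core39mTab : Array ℕ := certTable 9 3 core39mA core39mC (stdTable 7 9) 65521

/-- Core `core39m`: the packed pivoted LU candidate (unverified; validated by the checkers). -/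
def core39mLUP : Array ℕ × Array ℕ := packedLUP core39mTab (ballList 9 3).length 65521

/-- Core `core39m`: **THE CERTIFICATE CHECK** (computational, `Lean.ofReduceBool`): `L * U = P * M` entrywise mod `65521`, `diag U ≠ 0`,
`P` a permutation — for the `ballList 9 3`-indexed canonical matrix. -/
theorem core39m_check :
    (packCheckP core39mTab core39mLUP.1 core39mLUP.2 (ballList 9 3).length 65521 &&
      lupPermCheck core39mLUP.2 (lupPermInv core39mLUP.2 (ballList 9 3).length) (ballList 9 3).length) = true := by
  native_decide

/-- ★ Core `core39m` **IS SERVED** (standard form at the support `Fin 9`). -/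
theorem exists_table_core39m {r : ℕ} (u cols : Fin r → Finset (Fin 9)) (hu : Function.Injective u)
    (hU : ∀ i, ((u i).card ≤ 3 ∧ ∀ l, u i ≠ core39mA l) ∨ ∃ l, u i = core39mC l)
    (hcols : ∀ J : Finset (Fin 9), J.card ≤ 3 → ∃ k, cols k = J) :
    ∃ tx : Option (Fin 9) → Fin 9 → ℂ,
      (Matrix.of fun i k : Fin r => ∏ a ∈ u i, (tx none a + ∑ q ∈ cols k, tx (some q) a)).det ≠ 0 :=
  exists_table_of_packCert 9 3 core39mA core39mC (by decide +kernel) (by decide +kernel) (by decide +kernel) (by decide +kernel)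
    (stdTable 7 9) prime_65521 (by norm_num [packBase]) _ _ _ (Bool.and_eq_true_iff.mp core39m_check).1
    (Bool.and_eq_true_iff.mp core39m_check).2 u cols hu hU hcols

/-- ★ Core `core39m` **IS SERVED FOR EVERY `h`** (the core plus any number of free coordinates, along any `σ : Fin 9 ↪ Fin h`). -/
theorem exists_table_core39m_map (h : ℕ) (σ : Fin 9 ↪ Fin h) {r : ℕ} (u cols : Fin r → Finset (Fin h))
    (hu : Function.Injective u)
    (hU : ∀ i, ((u i).card ≤ 3 ∧ ∀ l, u i ≠ (core39mA l).map σ) ∨ ∃ l, u i = (core39mC l).map σ)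
    (hcols : ∀ J : Finset (Fin h), J.card ≤ 3 → ∃ k, cols k = J) :
    ∃ tx : Option (Fin h) → Fin h → ℂ,
      (Matrix.of fun i k : Fin r => ∏ a ∈ u i, (tx none a + ∑ q ∈ cols k, tx (some q) a)).det ≠ 0 :=
  exists_table_of_packCert_map 9 3 σ core39mA core39mC (by decide +kernel) (by decide +kernel) (by decide +kernel)
    (by decide +kernel) (stdTable 7 9) prime_65521 (by norm_num [packBase]) _ _ _
    (Bool.and_eq_true_iff.mp core39m_check).1 (Bool.and_eq_true_iff.mp core39m_check).2 u cols hu hU hcols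

/-! ### Core `core39n`: `n = 9`, `A = [[6, 7, 8], [3, 4, 5], [0, 1, 2]]`, `C = [[4, 5, 7, 8], [3, 5, 6, 8], [3, 4, 6, 7]]` -/

/-- Core `core39n`: the removed `3`-sets `A_l`. -/
def core39nA : Fin 3 → Finset (Fin 9) := ![{6, 7, 8}, {3, 4, 5}, {0, 1, 2}]

/-- Core `core39n`: the added `4`-sets `C_l`. -/
def core39nC : Fin 3 → Finset (Fin 9) := ![{4, 5, 7, 8}, {3, 5, 6, 8}, {3, 4, 6, 7}]

/-- Core `core39n`: the flat table of the canonical matrix modulo `65521` at `stdTable 7 9` (computed under evaluation). -/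
def core39nTab : Array ℕ := certTable 9 3 core39nA core39nC (stdTable 7 9) 65521

/-- Core `core39n`: the packed pivoted LU candidate (unverified; validated by the checkers). -/
def core39nLUP : Array ℕ × Array ℕ := packedLUP core39nTab (ballList 9 3).length 65521

/-- Core `core39n`: **THE CERTIFICATE CHECK** (computational, `Lean.ofReduceBool`): `L * U = P * M` entrywise mod `65521`, `diag U ≠ 0`,
`P` a permutation — for the `ballList 9 3`-indexed canonical matrix. -/
theorem core39n_check :
    (packCheckP core39nTab core39nLUP.1 core39nLUP.2 (ballList 9 3).length 65521 &&
      lupPermCheck core39nLUP.2 (lupPermInv core39nLUP.2 (ballList 9 3).length) (ballList 9 3).length) = true := by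
  native_decide

/-- ★ Core `core39n` **IS SERVED** (standard form at the support `Fin 9`). -/
theorem exists_table_core39n {r : ℕ} (u cols : Fin r → Finset (Fin 9)) (hu : Function.Injective u)
    (hU : ∀ i, ((u i).card ≤ 3 ∧ ∀ l, u i ≠ core39nA l) ∨ ∃ l, u i = core39nC l)
    (hcols : ∀ J : Finset (Fin 9), J.card ≤ 3 → ∃ k, cols k = J) :
    ∃ tx : Option (Fin 9) → Fin 9 → ℂ,
      (Matrix.of fun i k : Fin r => ∏ a ∈ u i, (tx none a + ∑ q ∈ cols k, tx (some q) a)).det ≠ 0 :=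
  exists_table_of_packCert 9 3 core39nA core39nC (by decide +kernel) (by decide +kernel) (by decide +kernel) (by decide +kernel)
    (stdTable 7 9) prime_65521 (by norm_num [packBase]) _ _ _ (Bool.and_eq_true_iff.mp core39n_check).1
    (Bool.and_eq_true_iff.mp core39n_check).2 u cols hu hU hcols

/-- ★ Core `core39n` **IS SERVED FOR EVERY `h`** (the core plus any number of free coordinates, along any `σ : Fin 9 ↪ Fin h`). -/
theorem exists_table_core39n_map (h : ℕ) (σ : Fin 9 ↪ Fin h) {r : ℕ} (u cols : Fin r → Finset (Fin h))
    (hu : Function.Injective u)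
    (hU : ∀ i, ((u i).card ≤ 3 ∧ ∀ l, u i ≠ (core39nA l).map σ) ∨ ∃ l, u i = (core39nC l).map σ)
    (hcols : ∀ J : Finset (Fin h), J.card ≤ 3 → ∃ k, cols k = J) :
    ∃ tx : Option (Fin h) → Fin h → ℂ,
      (Matrix.of fun i k : Fin r => ∏ a ∈ u i, (tx none a + ∑ q ∈ cols k, tx (some q) a)).det ≠ 0 :=
  exists_table_of_packCert_map 9 3 σ core39nA core39nC (by decide +kernel) (by decide +kernel) (by decide +kernel)
    (by decide +kernel) (stdTable 7 9) prime_65521 (by norm_num [packBase]) _ _ _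
    (Bool.and_eq_true_iff.mp core39n_check).1 (Bool.and_eq_true_iff.mp core39n_check).2 u cols hu hU hcols

/-! ### Core `core39o`: `n = 9`, `A = [[6, 7, 8], [3, 5, 8], [2, 5, 7]]`, `C = [[4, 5, 7, 8], [1, 2, 3, 6], [0, 2, 3, 6]]` -/

/-- Core `core39o`: the removed `3`-sets `A_l`. -/
def core39oA : Fin 3 → Finset (Fin 9) := ![{6, 7, 8}, {3, 5, 8}, {2, 5, 7}]

/-- Core `core39o`: the added `4`-sets `C_l`. -/
def core39oC : Fin 3 → Finset (Fin 9) := ![{4, 5, 7, 8}, {1, 2, 3, 6}, {0, 2, 3, 6}]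

/-- Core `core39o`: the flat table of the canonical matrix modulo `65521` at `stdTable 7 9` (computed under evaluation). -/
def core39oTab : Array ℕ := certTable 9 3 core39oA core39oC (stdTable 7 9) 65521

/-- Core `core39o`: the packed pivoted LU candidate (unverified; validated by the checkers). -/
def core39oLUP : Array ℕ × Array ℕ := packedLUP core39oTab (ballList 9 3).length 65521

/-- Core `core39o`: **THE CERTIFICATE CHECK** (computational, `Lean.ofReduceBool`): `L * U = P * M` entrywise mod `65521`, `diag U ≠ 0`,
`P` a permutation — for the `ballList 9 3`-indexed canonical matrix. -/
theorem core39o_check :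
    (packCheckP core39oTab core39oLUP.1 core39oLUP.2 (ballList 9 3).length 65521 &&
      lupPermCheck core39oLUP.2 (lupPermInv core39oLUP.2 (ballList 9 3).length) (ballList 9 3).length) = true := by
  native_decide

/-- ★ Core `core39o` **IS SERVED** (standard form at the support `Fin 9`). -/
theorem exists_table_core39o {r : ℕ} (u cols : Fin r → Finset (Fin 9)) (hu : Function.Injective u)
    (hU : ∀ i, ((u i).card ≤ 3 ∧ ∀ l, u i ≠ core39oA l) ∨ ∃ l, u i = core39oC l)
    (hcols : ∀ J : Finset (Fin 9), J.card ≤ 3 → ∃ k, cols k = J) :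
    ∃ tx : Option (Fin 9) → Fin 9 → ℂ,
      (Matrix.of fun i k : Fin r => ∏ a ∈ u i, (tx none a + ∑ q ∈ cols k, tx (some q) a)).det ≠ 0 :=
  exists_table_of_packCert 9 3 core39oA core39oC (by decide +kernel) (by decide +kernel) (by decide +kernel) (by decide +kernel)
    (stdTable 7 9) prime_65521 (by norm_num [packBase]) _ _ _ (Bool.and_eq_true_iff.mp core39o_check).1
    (Bool.and_eq_true_iff.mp core39o_check).2 u cols hu hU hcols

/-- ★ Core `core39o` **IS SERVED FOR EVERY `h`** (the core plus any number of free coordinates, along any `σ : Fin 9 ↪ Fin h`). -/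
theorem exists_table_core39o_map (h : ℕ) (σ : Fin 9 ↪ Fin h) {r : ℕ} (u cols : Fin r → Finset (Fin h))
    (hu : Function.Injective u)
    (hU : ∀ i, ((u i).card ≤ 3 ∧ ∀ l, u i ≠ (core39oA l).map σ) ∨ ∃ l, u i = (core39oC l).map σ)
    (hcols : ∀ J : Finset (Fin h), J.card ≤ 3 → ∃ k, cols k = J) :
    ∃ tx : Option (Fin h) → Fin h → ℂ,
      (Matrix.of fun i k : Fin r => ∏ a ∈ u i, (tx none a + ∑ q ∈ cols k, tx (some q) a)).det ≠ 0 :=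
  exists_table_of_packCert_map 9 3 σ core39oA core39oC (by decide +kernel) (by decide +kernel) (by decide +kernel)
    (by decide +kernel) (stdTable 7 9) prime_65521 (by norm_num [packBase]) _ _ _
    (Bool.and_eq_true_iff.mp core39o_check).1 (Bool.and_eq_true_iff.mp core39o_check).2 u cols hu hU hcols

/-! ### Core `core39p`: `n = 9`, `A = [[6, 7, 8], [3, 6, 8], [2, 6, 8]]`, `C = [[4, 5, 7, 8], [4, 5, 6, 7], [0, 1, 5, 7]]` -/

/-- Core `core39p`: the removed `3`-sets `A_l`. -/
def core39pA : Fin 3 → Finset (Fin 9) := ![{6, 7, 8}, {3, 6, 8}, {2, 6, 8}]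

/-- Core `core39p`: the added `4`-sets `C_l`. -/
def core39pC : Fin 3 → Finset (Fin 9) := ![{4, 5, 7, 8}, {4, 5, 6, 7}, {0, 1, 5, 7}]

/-- Core `core39p`: the flat table of the canonical matrix modulo `65521` at `stdTable 7 9` (computed under evaluation). -/
def core39pTab : Array ℕ := certTable 9 3 core39pA core39pC (stdTable 7 9) 65521

/-- Core `core39p`: the packed pivoted LU candidate (unverified; validated by the checkers). -/
def core39pLUP : Array ℕ × Array ℕ := packedLUP core39pTab (ballList 9 3).length 65521

/-- Core `core39p`: **THE CERTIFICATE CHECK** (computational, `Lean.ofReduceBool`): `L * U = P * M` entrywise mod `65521`, `diag U ≠ 0`,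
`P` a permutation — for the `ballList 9 3`-indexed canonical matrix. -/
theorem core39p_check :
    (packCheckP core39pTab core39pLUP.1 core39pLUP.2 (ballList 9 3).length 65521 &&
      lupPermCheck core39pLUP.2 (lupPermInv core39pLUP.2 (ballList 9 3).length) (ballList 9 3).length) = true := by
  native_decide

/-- ★ Core `core39p` **IS SERVED** (standard form at the support `Fin 9`). -/
theorem exists_table_core39p {r : ℕ} (u cols : Fin r → Finset (Fin 9)) (hu : Function.Injective u)
    (hU : ∀ i, ((u i).card ≤ 3 ∧ ∀ l, u i ≠ core39pA l) ∨ ∃ l, u i = core39pC l)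
    (hcols : ∀ J : Finset (Fin 9), J.card ≤ 3 → ∃ k, cols k = J) :
    ∃ tx : Option (Fin 9) → Fin 9 → ℂ,
      (Matrix.of fun i k : Fin r => ∏ a ∈ u i, (tx none a + ∑ q ∈ cols k, tx (some q) a)).det ≠ 0 :=
  exists_table_of_packCert 9 3 core39pA core39pC (by decide +kernel) (by decide +kernel) (by decide +kernel) (by decide +kernel)
    (stdTable 7 9) prime_65521 (by norm_num [packBase]) _ _ _ (Bool.and_eq_true_iff.mp core39p_check).1
    (Bool.and_eq_true_iff.mp core39p_check).2 u cols hu hU hcols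

/-- ★ Core `core39p` **IS SERVED FOR EVERY `h`** (the core plus any number of free coordinates, along any `σ : Fin 9 ↪ Fin h`). -/
theorem exists_table_core39p_map (h : ℕ) (σ : Fin 9 ↪ Fin h) {r : ℕ} (u cols : Fin r → Finset (Fin h))
    (hu : Function.Injective u)
    (hU : ∀ i, ((u i).card ≤ 3 ∧ ∀ l, u i ≠ (core39pA l).map σ) ∨ ∃ l, u i = (core39pC l).map σ)
    (hcols : ∀ J : Finset (Fin h), J.card ≤ 3 → ∃ k, cols k = J) :
    ∃ tx : Option (Fin h) → Fin h → ℂ,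
      (Matrix.of fun i k : Fin r => ∏ a ∈ u i, (tx none a + ∑ q ∈ cols k, tx (some q) a)).det ≠ 0 :=
  exists_table_of_packCert_map 9 3 σ core39pA core39pC (by decide +kernel) (by decide +kernel) (by decide +kernel)
    (by decide +kernel) (stdTable 7 9) prime_65521 (by norm_num [packBase]) _ _ _
    (Bool.and_eq_true_iff.mp core39p_check).1 (Bool.and_eq_true_iff.mp core39p_check).2 u cols hu hU hcols

end BallCut

end Summit.ValiantsHypothesis.ValiantsHypothesis.Theorems.BarrierLever.HiddenStates
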